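import Literature.MathematicalPhysics.QuantumLattice.HeisenbergOrderNeelGD
import HarnessLib

/-!
# Björnberg–Ueltschi: ground-state Gaussian domination for the anisotropic nearest-neighbour model

Sibling proof file of `XYZGroundStateOrder.lean` (named fact `bjornbergUeltschi2022_ground_lro`).
No statement of the tree is changed and no named fact is introduced. This file proves
**ground-state Gaussian domination** for B–U's nearest-neighbour Hamiltonian with couplings
`(J₁, J₂, 1)`, `J₁ ≥ 0 ≥ J₂` (B–U Corollary 5.3, `Z̃(v) ≤ Z̃(0)`, in the `β = ∞` form
`E₀(H'(0)) ≤ E₀(H'(h))` of Kennedy–Lieb–Shastry, J. Stat. Phys. 53 (1988), eq. (18)), for the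
field Hamiltonian in bond form

`H'(h) = Σ_{⟨xy⟩} [-J₁b⁰ - J₂b¹ - b² - (h_x - h_y)(S³_x - S³_y) + ½(h_x - h_y)²]`
(`xyzRealFieldHamiltonian`; B–U eq. (5.15): the field `v` enters through
`(S³_x + v_x/2)(S³_y + v_y/2)`, i.e. only the third component is completed to a square).

The proof is the tree's ground-state reflection-positivity route for the XY model
(`XYOrderReflection.lean` / `XYOrderGDProofs.lean`, Kennedy–Lieb–Shastry eqs. (20)–(25)) with the
bond term replaced: **no sublattice rotation is needed** — in the basis where `S³` is diagonal,
`S¹` and `S³` are real and `S²` is imaginary, so with `J₁ ≥ 0`, `J₂ ≤ 0` every crossing term is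
`-M ⊗ M` with a real `M` (B–U eq. (5.16): "`J¹S¹_xS¹_y - J²(iS²_x)(iS²_y) + J³(…)(…)` … the measure
`μ` needs to be positive, which is guaranteed by `J¹, J³ ≥ 0` and `J² ≤ 0`"). To keep the crossing
operators polynomial in the couplings we parametrise `J₁ = s₁²`, `J₂ = -s₂²`:

* `xyzRealBond`, `xyzRealFieldHamiltonian` (the bond form of `H'(h)`), `xyzLeftHamiltonian`,
  `xyzCrossOp` (`M_{(x,0)} = s₁S¹_x`, `M_{(x,1)} = s₂·iS²_x`, `M_{(x,2)} = S³_x - h_x`), and the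
  Kronecker form `xyzRealFieldHamiltonian_eq_submatrix` (KLS eq. (21) / B–U (5.16));
* `xyz_groundEnergy_reflect_le`: `½E(h^L) + ½E(h^R) ≤ E(h)` (`Matrix.kls_groundEnergy_reflection`);
* the descent on the number of bonds with `h_x ≠ h_y` (`badBondCount_reflect`), giving
  `xyz_gaussianDomination_real`: on even tori of side `L ≥ 4`, `E₀(H'(0)) ≤ E₀(H'(h))` for all
  real fields `h` (B–U Cor. 5.3 at `β = ∞`; KLS eq. (18)).

## References

* [BjornbergUeltschi2022] Lemma 5.1, Lemma 5.2 (nearest-neighbour case, eqs. (5.15)–(5.16)),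
  Corollary 5.3.
* [KLS1988JSP] T. Kennedy, E. H. Lieb, B. S. Shastry, J. Stat. Phys. 53 (1988) 1019–1030,
  eqs. (17)–(25).
-/

noncomputable section

open Matrix Finset Filter Topology
open scoped ComplexOrder Kronecker
open Literature.MathematicalPhysics.QuantumLattice Literature.MathematicalPhysics.QuantumLattice.SpinOperators
  Literature.Probability.LatticeModels

namespace Literature.MathematicalPhysics.QuantumLattice

variable {d : ℕ}

/-! ### The real bond term with the field on the third component -/

section RealBond

variable {Λ : Type*} [Fintype Λ] [DecidableEq Λ]

/-- The bond term of the field Hamiltonian,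
`τ_h(x,y) = -J₁b⁰_{xy} - J₂b¹_{xy} - b²_{xy} - (h_x - h_y)(S³_x - S³_y) + ½(h_x - h_y)²`, i.e. B–U's
nearest-neighbour bond with the third coupling `1` and the field put on the third component by
completing the square (eq. (5.15)). Symmetric in `x, y`; a real matrix in the tensor basis.
[cite: BjornbergUeltschi2022, eq. (5.15)] -/
def xyzRealBond (n : ℕ) (J₁ J₂ : ℝ) (h : Λ → ℝ) (x y : Λ) : Op Λ (n + 1) :=
  -((J₁ : ℂ) • spinBond n 0 x y) - (J₂ : ℂ) • spinBond n 1 x y - spinBond n 2 x y -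
    ((h x - h y : ℝ) : ℂ) • (siteSpin n x 2 - siteSpin n y 2) +
    (((h x - h y) ^ 2 / 2 : ℝ) : ℂ) • 1

/-- `τ_h(x,y)` is a real matrix (`S¹`, `S³` real, `S²S²` real). [cite: BjornbergUeltschi2022,
Lemma 5.2 (proof: "`S¹_x = S̄¹_x`, `iS²_x = i S̄²_x`, `S³_x = S̄³_x`")] -/
theorem xyzRealBond_transpose_eq (n : ℕ) (J₁ J₂ : ℝ) (h : Λ → ℝ) (x y : Λ) :
    (xyzRealBond n J₁ J₂ h x y)ᵀ = (xyzRealBond n J₁ J₂ h x y)ᴴ := by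
  unfold xyzRealBond
  have h2x := siteSpin_two_transpose_eq (Λ := Λ) n x
  have h2y := siteSpin_two_transpose_eq (Λ := Λ) n y
  have hb0 : (spinBond n 0 x y : Op Λ (n + 1))ᵀ = (spinBond n 0 x y)ᴴ := by
    unfold spinBond
    have h0x := siteSpin_zero_transpose_eq (Λ := Λ) n x
    have h0y := siteSpin_zero_transpose_eq (Λ := Λ) n y
    rw [show (1 / 2 : ℂ) = ((1 / 2 : ℝ) : ℂ) by push_cast; ring]
    exact transpose_eq_conjTranspose_ofReal_smul (transpose_eq_conjTranspose_add
      (transpose_eq_conjTranspose_mul h0x h0y) (transpose_eq_conjTranspose_mul h0y h0x)) _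
  have hb1 : (spinBond n 1 x y : Op Λ (n + 1))ᵀ = (spinBond n 1 x y)ᴴ := by
    unfold spinBond
    rw [show (1 / 2 : ℂ) = ((1 / 2 : ℝ) : ℂ) by push_cast; ring]
    exact transpose_eq_conjTranspose_ofReal_smul (transpose_eq_conjTranspose_add
      (siteSpin_one_mul_transpose_eq n x y) (siteSpin_one_mul_transpose_eq n y x)) _
  refine transpose_eq_conjTranspose_add (transpose_eq_conjTranspose_sub
    (transpose_eq_conjTranspose_sub (transpose_eq_conjTranspose_sub
      (transpose_eq_conjTranspose_neg (transpose_eq_conjTranspose_ofReal_smul hb0 _))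
      (transpose_eq_conjTranspose_ofReal_smul hb1 _)) (spinBond_two_transpose_eq n x y)) ?_) ?_
  · exact transpose_eq_conjTranspose_ofReal_smul (transpose_eq_conjTranspose_sub h2x h2y) _
  · exact transpose_eq_conjTranspose_ofReal_smul transpose_eq_conjTranspose_one _

/-- `τ_h` is symmetric in the two sites. [folklore] -/
theorem xyzRealBond_comm (n : ℕ) (J₁ J₂ : ℝ) (h : Λ → ℝ) (x y : Λ) :
    xyzRealBond n J₁ J₂ h x y = xyzRealBond n J₁ J₂ h y x := by
  simp only [xyzRealBond, spinBond_comm n _ x y]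
  congr 2
  · rw [← neg_sub (h y) (h x), Complex.ofReal_neg, neg_smul, ← smul_neg, neg_sub]
  · rw [← neg_sub (h y) (h x), neg_sq]

/-- `τ_h(x,y)` depends on the field only through its values at the two sites. [folklore] -/
theorem xyzRealBond_congr (n : ℕ) (J₁ J₂ : ℝ) {h₁ h₂ : Λ → ℝ} {x y : Λ} (hx : h₁ x = h₂ x)
    (hy : h₁ y = h₂ y) : xyzRealBond n J₁ J₂ h₁ x y = xyzRealBond n J₁ J₂ h₂ x y := by
  simp only [xyzRealBond, hx, hy]

/-- On a bond with `h_x = h_y` the field terms vanish. [folklore] -/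
theorem xyzRealBond_eq_of_eq (n : ℕ) (J₁ J₂ : ℝ) {h : Λ → ℝ} {x y : Λ} (hxy : h x = h y) :
    xyzRealBond n J₁ J₂ h x y = xyzRealBond n J₁ J₂ (fun _ => 0) x y := by
  simp only [xyzRealBond, hxy, sub_self]

/-- `τ_h(x,y)` is Hermitian. [folklore] -/
theorem xyzRealBond_isHermitian (n : ℕ) (J₁ J₂ : ℝ) (h : Λ → ℝ) (x y : Λ) :
    (xyzRealBond n J₁ J₂ h x y).IsHermitian := by
  unfold xyzRealBond
  have hr : ∀ r : ℝ, IsSelfAdjoint (r : ℂ) := fun r => by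
    rw [isSelfAdjoint_iff, Complex.star_def, Complex.conj_ofReal]
  refine (((((spinBond_isHermitian n 0 x y).smul (hr _)).neg.sub
    ((spinBond_isHermitian n 1 x y).smul (hr _))).sub (spinBond_isHermitian n 2 x y)).sub
    (((siteSpin_isHermitian n x 2).sub (siteSpin_isHermitian n y 2)).smul (hr _))).add
    (isHermitian_one.smul (hr _))

end RealBond

/-- **The field Hamiltonian in bond form** `H'(h) = Σ_{⟨xy⟩} τ_h(x,y)` on the torus
(B–U's `H(v)` of eq. (5.10)–(5.15) with `v = 2h`, up to the constant; at `h = 0` it is the bond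
form `-Σ(J₁b⁰ + J₂b¹ + b²)` of the Hamiltonian). [cite: BjornbergUeltschi2022, eqs. (5.10), (5.15)] -/
def xyzRealFieldHamiltonian (L : ℕ) [NeZero L] (n : ℕ) (J₁ J₂ : ℝ) (h : TorusSite d L → ℝ) :
    Op (TorusSite d L) (n + 1) :=
  ∑ e ∈ (torusGraph d L).edgeFinset,
    Sym2.lift ⟨fun x y => xyzRealBond n J₁ J₂ h x y, fun _ _ => xyzRealBond_comm n J₁ J₂ h _ _⟩ e

section Halves

variable (L : ℕ) [NeZero L] (j : Fin d) (a : ZMod L)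

/-- **The left Hamiltonian** along the planes `θ = Torus.reflectBetweenSites j a`: the bond terms
of the left bonds plus the on-site terms `½h_x² - h_x S³_x` of the left endpoints of the crossing
bonds (KLS eq. (21), `H^L`; B–U eq. (5.16), the operator `A`). [cite: BjornbergUeltschi2022,
eq. (5.16)] -/
def xyzLeftHamiltonian (hL : Even L) (n : ℕ) (J₁ J₂ : ℝ) (h : TorusSite d L → ℝ) :
    Op (torusLeftHalf L j a) (n + 1) :=
  (∑ e ∈ torusLeftEdges L j a,
    Sym2.lift ⟨fun x y => xyzRealBond n J₁ J₂ (fun z : torusLeftHalf L j a => h z)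
        (torusToLeft L j a hL x) (torusToLeft L j a hL y), fun _ _ =>
      xyzRealBond_comm n J₁ J₂ _ _ _⟩ e) +
  ∑ x ∈ torusCrossSites L j a,
    ((((h x) ^ 2 / 2 : ℝ) : ℂ) • (1 : Op (torusLeftHalf L j a) (n + 1)) -
      ((h x : ℝ) : ℂ) • siteSpin n (torusToLeft L j a hL x) 2)

/-- **The crossing operators** (B–U eq. (5.16), the three terms `J¹S¹_xS¹_y`,
`-J²(iS²_x)(iS²_y)`, `J³(S³_x + v_x/2)(S³_y + v_y/2)` of a crossing bond, here with `J₁ = s₁²`,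
`J₂ = -s₂²`): for a left endpoint `x` of a crossing bond, `M_{(x,0)} = s₁S¹_x`, `M_{(x,1)} = s₂·iS²_x`,
`M_{(x,2)} = S³_x - h_x` (real matrices). [cite: BjornbergUeltschi2022, eq. (5.16)] -/
def xyzCrossOp (hL : Even L) (n : ℕ) (s₁ s₂ : ℝ) (h : TorusSite d L → ℝ)
    (p : torusCrossSites L j a × Fin 3) : Op (torusLeftHalf L j a) (n + 1) :=
  ![((s₁ : ℝ) : ℂ) • siteSpin n (torusToLeft L j a hL p.1) 0,
    ((s₂ : ℝ) : ℂ) • (Complex.I • siteSpin n (torusToLeft L j a hL p.1) 1),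
    siteSpin n (torusToLeft L j a hL p.1) 2 - ((h p.1 : ℝ) : ℂ) • 1] p.2

end Halves

/-! ### The Kronecker form along a pair of planes -/

section Embeddings

variable {L : ℕ} [NeZero L] {j : Fin d} {a : ZMod L} {hL : Even L}

/-- Pushing an algebra homomorphism through the bond term. [folklore] -/
theorem map_xyzRealBond {Λ Λ' : Type*} [Fintype Λ] [DecidableEq Λ] [Fintype Λ'] [DecidableEq Λ']
    (n : ℕ) (J₁ J₂ : ℝ) (φ : Op Λ (n + 1) →ₐ[ℂ] Op Λ' (n + 1)) (h : Λ → ℝ) (x y : Λ) :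
    φ (xyzRealBond n J₁ J₂ h x y) =
      -((J₁ : ℂ) • ((1 / 2 : ℂ) • (φ (siteSpin n x 0) * φ (siteSpin n y 0) +
          φ (siteSpin n y 0) * φ (siteSpin n x 0)))) -
        (J₂ : ℂ) • ((1 / 2 : ℂ) • (φ (siteSpin n x 1) * φ (siteSpin n y 1) +
          φ (siteSpin n y 1) * φ (siteSpin n x 1))) -
        (1 / 2 : ℂ) • (φ (siteSpin n x 2) * φ (siteSpin n y 2) +
          φ (siteSpin n y 2) * φ (siteSpin n x 2)) -
        ((h x - h y : ℝ) : ℂ) • (φ (siteSpin n x 2) - φ (siteSpin n y 2)) +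
        (((h x - h y) ^ 2 / 2 : ℝ) : ℂ) • 1 := by
  simp only [xyzRealBond, spinBond, map_add, map_sub, map_neg, map_smul, map_mul, map_one]

/-- **Left bonds are `τ ⊗ 1`.** [cite: KLS1988JSP, eq. (21)] -/
theorem xyzRealBond_eq_torusLeftEmbed (n : ℕ) (J₁ J₂ : ℝ) (g : TorusSite d L → ℝ) {x y : TorusSite d L}
    (hx : x ∈ torusLeftHalf L j a) (hy : y ∈ torusLeftHalf L j a) :
    xyzRealBond n J₁ J₂ g x y = torusLeftEmbed L j a hL
      (xyzRealBond n J₁ J₂ (fun s : torusLeftHalf L j a => g s)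
        (torusToLeft L j a hL x) (torusToLeft L j a hL y)) := by
  rw [map_xyzRealBond, ← siteSpin_eq_torusLeftEmbed n hx, ← siteSpin_eq_torusLeftEmbed n hy,
    ← siteSpin_eq_torusLeftEmbed n hx, ← siteSpin_eq_torusLeftEmbed n hy,
    ← siteSpin_eq_torusLeftEmbed n hx, ← siteSpin_eq_torusLeftEmbed n hy,
    torusToLeft_val_of_mem L j a hL hx, torusToLeft_val_of_mem L j a hL hy]
  rfl

/-- **Right bonds are `1 ⊗ τ`** (with the reflected field). [cite: KLS1988JSP, eq. (21)] -/
theorem xyzRealBond_eq_torusRightEmbed (n : ℕ) (J₁ J₂ : ℝ) (g : TorusSite d L → ℝ) {z w : TorusSite d L}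
    (hz : z ∉ torusLeftHalf L j a) (hw : w ∉ torusLeftHalf L j a) :
    xyzRealBond n J₁ J₂ g z w = torusRightEmbed L j a hL
      (xyzRealBond n J₁ J₂ (fun s : torusLeftHalf L j a => g (Torus.reflectBetweenSites j a s))
        (torusToLeft L j a hL z) (torusToLeft L j a hL w)) := by
  rw [map_xyzRealBond, ← siteSpin_eq_torusRightEmbed n hz, ← siteSpin_eq_torusRightEmbed n hw,
    ← siteSpin_eq_torusRightEmbed n hz, ← siteSpin_eq_torusRightEmbed n hw,
    ← siteSpin_eq_torusRightEmbed n hz, ← siteSpin_eq_torusRightEmbed n hw,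
    torusToLeft_of_not_mem L j a hL hz, torusToLeft_of_not_mem L j a hL hw]
  simp only [reflectBetweenSites_reflectBetweenSites]
  rfl

/-- **Crossing bonds** (B–U eq. (5.16) / KLS eq. (20)): for a left endpoint `x` of a crossing bond
`{x, θx}` and couplings `J₁ = s₁²`, `J₂ = -s₂²`,
`τ_g(x, θx) = (½g_x² - g_xS³) ⊗ 1 + 1 ⊗ (½g_{θx}² - g_{θx}S³) - Σ_{c} M_{(x,c)}(g) ⊗ M_{(x,c)}(g ∘ θ)`.
[cite: BjornbergUeltschi2022, eq. (5.16)] -/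
theorem xyzRealBond_cross (n : ℕ) (s₁ s₂ : ℝ) (g : TorusSite d L → ℝ) (x : torusCrossSites L j a) :
    xyzRealBond n (s₁ ^ 2) (-(s₂ ^ 2)) g x (Torus.reflectBetweenSites j a x) =
      torusLeftEmbed L j a hL ((((g x) ^ 2 / 2 : ℝ) : ℂ) • 1 -
          ((g x : ℝ) : ℂ) • siteSpin n (torusToLeft L j a hL x) 2) +
        torusRightEmbed L j a hL ((((g (Torus.reflectBetweenSites j a x)) ^ 2 / 2 : ℝ) : ℂ) • 1 -
          ((g (Torus.reflectBetweenSites j a x) : ℝ) : ℂ) • siteSpin n (torusToLeft L j a hL x) 2) -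
        ∑ c : Fin 3, torusLeftEmbed L j a hL (xyzCrossOp L j a hL n s₁ s₂ g (x, c)) *
            torusRightEmbed L j a hL
              (xyzCrossOp L j a hL n s₁ s₂ (fun y => g (Torus.reflectBetweenSites j a y)) (x, c)) := by
  have hx : (x : TorusSite d L) ∈ torusLeftHalf L j a := (mem_torusCrossSites.1 x.2).1
  have hθ : Torus.reflectBetweenSites j a x ∉ torusLeftHalf L j a := fun h =>
    (reflectBetweenSites_mem_torusLeftHalf_iff L j a hL (x : TorusSite d L)).1 h hx
  have eL : ∀ α : Fin 3, (siteSpin n (x : TorusSite d L) α : Op (TorusSite d L) (n + 1)) =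
      torusLeftEmbed L j a hL (siteSpin n (torusToLeft L j a hL x) α) := fun α =>
    siteSpin_eq_torusLeftEmbed n hx α
  have eR : ∀ α : Fin 3, (siteSpin n (Torus.reflectBetweenSites j a x) α : Op (TorusSite d L) (n + 1)) =
      torusRightEmbed L j a hL (siteSpin n (torusToLeft L j a hL x) α) := fun α => by
    rw [siteSpin_eq_torusRightEmbed n hθ, torusToLeft_reflectBetweenSites]
  -- atoms
  set X : Op (torusLeftHalf L j a) (n + 1) := siteSpin n (torusToLeft L j a hL x) 0 with hX
  set Y : Op (torusLeftHalf L j a) (n + 1) := siteSpin n (torusToLeft L j a hL x) 1 with hY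
  set Z : Op (torusLeftHalf L j a) (n + 1) := siteSpin n (torusToLeft L j a hL x) 2 with hZ
  have hPX : torusLeftEmbed L j a hL X * torusRightEmbed L j a hL X =
      torusRightEmbed L j a hL X * torusLeftEmbed L j a hL X := by
    rw [torusLeftEmbed_mul_torusRightEmbed, torusRightEmbed_mul_torusLeftEmbed]
  have hPY : torusLeftEmbed L j a hL Y * torusRightEmbed L j a hL Y =
      torusRightEmbed L j a hL Y * torusLeftEmbed L j a hL Y := by
    rw [torusLeftEmbed_mul_torusRightEmbed, torusRightEmbed_mul_torusLeftEmbed]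
  have hPZ : torusLeftEmbed L j a hL Z * torusRightEmbed L j a hL Z =
      torusRightEmbed L j a hL Z * torusLeftEmbed L j a hL Z := by
    rw [torusLeftEmbed_mul_torusRightEmbed, torusRightEmbed_mul_torusLeftEmbed]
  rw [Fin.sum_univ_three]
  simp only [xyzRealBond, spinBond, xyzCrossOp, Matrix.cons_val_zero, Matrix.cons_val_one,
    Matrix.cons_val_two, Matrix.head_cons, Matrix.tail_cons, map_sub, map_smul, map_one]
  simp only [eL, eR]
  simp only [← hX, ← hY, ← hZ]
  clear_value X Y Z
  simp only [mul_sub, sub_mul, smul_mul_assoc, mul_smul_comm, Matrix.one_mul, Matrix.mul_one,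
    smul_sub, smul_smul]
  have hI : (s₂ : ℂ) * Complex.I * ((s₂ : ℂ) * Complex.I) = -((s₂ : ℂ) ^ 2) := by
    have : Complex.I * Complex.I = -1 := Complex.I_mul_I
    linear_combination ((s₂ : ℂ) ^ 2) * this
  rw [← hPX, ← hPY, ← hPZ, hI]
  push_cast
  module

variable (L j a hL)

/-- **The Kronecker form of the field Hamiltonian** (KLS eq. (21); B–U eq. (5.16)): under the
tensor-square identification along `θ`, for couplings `J₁ = s₁²`, `J₂ = -s₂²`,
`H'(g) = H^L(g) ⊗ 1 + 1 ⊗ H^L(g ∘ θ) - Σᵢ Mᵢ(g) ⊗ Mᵢ(g ∘ θ)`. [cite: BjornbergUeltschi2022, eq. (5.16)] -/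
theorem xyzRealFieldHamiltonian_eq_submatrix (n : ℕ) (s₁ s₂ : ℝ) (g : TorusSite d L → ℝ) :
    xyzRealFieldHamiltonian L n (s₁ ^ 2) (-(s₂ ^ 2)) g =
      (xyzLeftHamiltonian L j a hL n (s₁ ^ 2) (-(s₂ ^ 2)) g ⊗ₖ (1 : Op (torusLeftHalf L j a) (n + 1)) +
          (1 : Op (torusLeftHalf L j a) (n + 1)) ⊗ₖ
            xyzLeftHamiltonian L j a hL n (s₁ ^ 2) (-(s₂ ^ 2)) (fun y => g (Torus.reflectBetweenSites j a y)) -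
          ∑ i, xyzCrossOp L j a hL n s₁ s₂ g i ⊗ₖ
            xyzCrossOp L j a hL n s₁ s₂ (fun y => g (Torus.reflectBetweenSites j a y)) i).submatrix
        (torusSplit L j a hL) (torusSplit L j a hL) := by
  rw [submatrix_kroneckerForm, xyzRealFieldHamiltonian, sum_edgeFinset_split L j a hL]
  set J₁ : ℝ := s₁ ^ 2 with hJ₁
  set J₂ : ℝ := -(s₂ ^ 2) with hJ₂
  -- names for the half-space summands
  set TL : Sym2 (TorusSite d L) → Op (torusLeftHalf L j a) (n + 1) := fun e =>
    Sym2.lift ⟨fun x y => xyzRealBond n J₁ J₂ (fun z : torusLeftHalf L j a => g z)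
      (torusToLeft L j a hL x) (torusToLeft L j a hL y),
      fun x y => xyzRealBond_comm n J₁ J₂ _ _ _⟩ e with hTL
  set TR : Sym2 (TorusSite d L) → Op (torusLeftHalf L j a) (n + 1) := fun e =>
    Sym2.lift ⟨fun x y => xyzRealBond n J₁ J₂
      (fun z : torusLeftHalf L j a => g (Torus.reflectBetweenSites j a z))
      (torusToLeft L j a hL x) (torusToLeft L j a hL y),
      fun x y => xyzRealBond_comm n J₁ J₂ _ _ _⟩ e with hTR
  -- (1) left bonds
  have h1 : ∑ e ∈ torusLeftEdges L j a,
      Sym2.lift ⟨fun x y => xyzRealBond n J₁ J₂ g x y, fun x y => xyzRealBond_comm n J₁ J₂ g x y⟩ e =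
        torusLeftEmbed L j a hL (∑ e ∈ torusLeftEdges L j a, TL e) := by
    rw [map_sum]
    refine sum_congr rfl fun e he => ?_
    obtain ⟨-, hl⟩ := mem_filter.1 he
    revert hl
    refine Sym2.ind (fun x y => ?_) e
    intro hl
    simp only [hTL, Sym2.lift_mk]
    exact xyzRealBond_eq_torusLeftEmbed n J₁ J₂ g (hl x (Sym2.mem_mk_left x y))
      (hl y (Sym2.mem_mk_right x y))
  -- (2) right bonds
  have h2 : ∑ e ∈ ((torusGraph d L).edgeFinset.filter fun e => ∀ x ∈ e, x ∉ torusLeftHalf L j a),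
      Sym2.lift ⟨fun x y => xyzRealBond n J₁ J₂ g x y, fun x y => xyzRealBond_comm n J₁ J₂ g x y⟩ e =
        torusRightEmbed L j a hL (∑ e ∈ torusLeftEdges L j a, TR e) := by
    rw [← sum_rightEdges_eq_sum_leftEdges L j a hL TR, map_sum]
    · refine sum_congr rfl fun e he => ?_
      obtain ⟨-, hr⟩ := mem_filter.1 he
      revert hr
      refine Sym2.ind (fun x y => ?_) e
      intro hr
      simp only [hTR, Sym2.lift_mk]
      exact xyzRealBond_eq_torusRightEmbed n J₁ J₂ g (hr x (Sym2.mem_mk_left x y))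
        (hr y (Sym2.mem_mk_right x y))
    · intro e
      refine Sym2.ind (fun x y => ?_) e
      simp only [hTR, Sym2.map_mk, Sym2.lift_mk, torusToLeft_reflectBetweenSites]
  -- (3) crossing bonds
  have h3 : ∑ x ∈ torusCrossSites L j a,
      Sym2.lift ⟨fun x y => xyzRealBond n J₁ J₂ g x y, fun x y => xyzRealBond_comm n J₁ J₂ g x y⟩
        s(x, Torus.reflectBetweenSites j a x) =
      torusLeftEmbed L j a hL (∑ x ∈ torusCrossSites L j a,
          ((((g x) ^ 2 / 2 : ℝ) : ℂ) • (1 : Op (torusLeftHalf L j a) (n + 1)) -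
            ((g x : ℝ) : ℂ) • siteSpin n (torusToLeft L j a hL x) 2)) +
        torusRightEmbed L j a hL (∑ x ∈ torusCrossSites L j a,
          ((((g (Torus.reflectBetweenSites j a x)) ^ 2 / 2 : ℝ) : ℂ) • (1 : Op (torusLeftHalf L j a) (n + 1)) -
            ((g (Torus.reflectBetweenSites j a x) : ℝ) : ℂ) • siteSpin n (torusToLeft L j a hL x) 2)) -
        ∑ i : torusCrossSites L j a × Fin 3, torusLeftEmbed L j a hL (xyzCrossOp L j a hL n s₁ s₂ g i) *
          torusRightEmbed L j a hL
            (xyzCrossOp L j a hL n s₁ s₂ (fun y => g (Torus.reflectBetweenSites j a y)) i) := by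
    rw [map_sum, map_sum, Fintype.sum_prod_type, ← Finset.sum_coe_sort (torusCrossSites L j a),
      ← Finset.sum_coe_sort (torusCrossSites L j a), ← Finset.sum_coe_sort (torusCrossSites L j a),
      ← sum_add_distrib, ← sum_sub_distrib]
    refine sum_congr rfl fun x _ => ?_
    rw [Sym2.lift_mk]
    exact xyzRealBond_cross n s₁ s₂ g x
  rw [h1, h2, h3, xyzLeftHamiltonian, xyzLeftHamiltonian, map_add, map_add]
  abel

end Embeddings

/-! ### Hermiticity and reality of the half-space operators -/

section HalfSpace

variable (L : ℕ) [NeZero L] (j : Fin d) (a : ZMod L) (n : ℕ) (J₁ J₂ : ℝ)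

/-- `H'(h)` is Hermitian. [folklore] -/
theorem xyzRealFieldHamiltonian_isHermitian (h : TorusSite d L → ℝ) :
    (xyzRealFieldHamiltonian L n J₁ J₂ h).IsHermitian :=
  isHermitian_sum_lift _ _ fun x y => xyzRealBond_isHermitian n J₁ J₂ h x y

/-- `H^L(h)` is Hermitian. [folklore] -/
theorem xyzLeftHamiltonian_isHermitian (hL : Even L) (h : TorusSite d L → ℝ) :
    (xyzLeftHamiltonian L j a hL n J₁ J₂ h).IsHermitian := by
  unfold xyzLeftHamiltonian
  refine Matrix.IsHermitian.add ?_ ?_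
  · rw [IsHermitian, conjTranspose_sum]
    refine sum_congr rfl fun e _ => ?_
    induction e using Sym2.ind with
    | h x y =>
      simp only [Sym2.lift_mk]
      exact (xyzRealBond_isHermitian n J₁ J₂ _ _ _).eq
  · rw [IsHermitian, conjTranspose_sum]
    refine sum_congr rfl fun x _ => ?_
    exact ((isHermitian_one.smul (isSelfAdjoint_ofReal _)).sub
      ((siteSpin_isHermitian n _ 2).smul (isSelfAdjoint_ofReal _))).eq

/-- `H^L(h)` is a real matrix. [cite: BjornbergUeltschi2022, Lemma 5.2 (proof: "`A = Ā`")] -/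
theorem xyzLeftHamiltonian_transpose_eq (hL : Even L) (h : TorusSite d L → ℝ) :
    (xyzLeftHamiltonian L j a hL n J₁ J₂ h)ᵀ = (xyzLeftHamiltonian L j a hL n J₁ J₂ h)ᴴ := by
  unfold xyzLeftHamiltonian
  rw [transpose_add, conjTranspose_add, transpose_sum, conjTranspose_sum, transpose_sum,
    conjTranspose_sum]
  congr 1
  · refine sum_congr rfl fun e _ => ?_
    induction e using Sym2.ind with
    | h x y =>
      simp only [Sym2.lift_mk]
      exact xyzRealBond_transpose_eq n J₁ J₂ _ _ _
  · refine sum_congr rfl fun x _ => ?_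
    exact transpose_eq_conjTranspose_sub
      (transpose_eq_conjTranspose_ofReal_smul transpose_eq_conjTranspose_one _)
      (transpose_eq_conjTranspose_ofReal_smul (siteSpin_two_transpose_eq n _) _)

/-- `H^L(h)` is complex-symmetric. [folklore] -/
theorem xyzLeftHamiltonian_transpose (hL : Even L) (h : TorusSite d L → ℝ) :
    (xyzLeftHamiltonian L j a hL n J₁ J₂ h)ᵀ = xyzLeftHamiltonian L j a hL n J₁ J₂ h := by
  rw [xyzLeftHamiltonian_transpose_eq, (xyzLeftHamiltonian_isHermitian L j a n J₁ J₂ hL h).eq]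

/-- The crossing operators are real matrices (`S¹`, `iS²`, `S³ - h_x` real).
[cite: BjornbergUeltschi2022, Lemma 5.2 (proof: "`Cᵢ = C̄ᵢ`")] -/
theorem xyzCrossOp_transpose_eq (hL : Even L) (s₁ s₂ : ℝ) (h : TorusSite d L → ℝ)
    (i : torusCrossSites L j a × Fin 3) :
    (xyzCrossOp L j a hL n s₁ s₂ h i)ᵀ = (xyzCrossOp L j a hL n s₁ s₂ h i)ᴴ := by
  rcases i with ⟨x, i⟩
  fin_cases i
  · simp only [xyzCrossOp, Fin.zero_eta, Matrix.cons_val_zero]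
    exact transpose_eq_conjTranspose_ofReal_smul (siteSpin_zero_transpose_eq n _) _
  · simp only [xyzCrossOp, Fin.mk_one, Matrix.cons_val_one]
    exact transpose_eq_conjTranspose_ofReal_smul (I_smul_siteSpin_one_transpose_eq n _) _
  · simp only [xyzCrossOp, Fin.reduceFinMk, Matrix.cons_val_two, Matrix.tail_cons, Matrix.head_cons]
    exact transpose_eq_conjTranspose_sub (siteSpin_two_transpose_eq n _)
      (transpose_eq_conjTranspose_ofReal_smul transpose_eq_conjTranspose_one _)

/-- `H^L(h)` depends on `h` only through `h` on the left half. [folklore] -/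
theorem xyzLeftHamiltonian_congr (hL : Even L) {h₁ h₂ : TorusSite d L → ℝ}
    (hh : ∀ x ∈ torusLeftHalf L j a, h₁ x = h₂ x) :
    xyzLeftHamiltonian L j a hL n J₁ J₂ h₁ = xyzLeftHamiltonian L j a hL n J₁ J₂ h₂ := by
  unfold xyzLeftHamiltonian
  congr 1
  · refine sum_congr rfl fun e _ => ?_
    induction e using Sym2.ind with
    | h x y =>
      simp only [Sym2.lift_mk]
      exact xyzRealBond_congr n J₁ J₂ (hh _ (torusToLeft L j a hL x).2) (hh _ (torusToLeft L j a hL y).2)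
  · refine sum_congr rfl fun x hx => ?_
    rw [hh x (mem_filter.1 hx).1]

/-- The crossing operators depend on `h` only through `h` on the left half. [folklore] -/
theorem xyzCrossOp_congr (hL : Even L) (s₁ s₂ : ℝ) {h₁ h₂ : TorusSite d L → ℝ}
    (hh : ∀ x ∈ torusLeftHalf L j a, h₁ x = h₂ x) :
    xyzCrossOp L j a hL n s₁ s₂ h₁ = xyzCrossOp L j a hL n s₁ s₂ h₂ := by
  funext i
  rcases i with ⟨x, i⟩
  fin_cases i
  · rfl
  · rfl
  · simp only [xyzCrossOp, Fin.reduceFinMk, Matrix.cons_val_two, Matrix.tail_cons, Matrix.head_cons]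
    rw [hh x (mem_filter.1 x.2).1]

/-- **The reflection inequality for the ground-state energy** (KLS, the display after eq. (25);
B–U Lemma 5.2 at `β = ∞`): for the field Hamiltonian with couplings `J₁ = s₁²`, `J₂ = -s₂²` on an
even torus and every pair of planes, `½E(h^L) + ½E(h^R) ≤ E(h)`.
[cite: BjornbergUeltschi2022, Lemma 5.2] -/
theorem xyz_groundEnergy_reflect_le (hL : Even L) (s₁ s₂ : ℝ) (h : TorusSite d L → ℝ) :
    ((xyzRealFieldHamiltonian L n (s₁ ^ 2) (-(s₂ ^ 2)) (reflectFieldLeft L j a h)).groundEnergy +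
        (xyzRealFieldHamiltonian L n (s₁ ^ 2) (-(s₂ ^ 2)) (reflectFieldRight L j a h)).groundEnergy) / 2 ≤
      (xyzRealFieldHamiltonian L n (s₁ ^ 2) (-(s₂ ^ 2)) h).groundEnergy := by
  set J₁ : ℝ := s₁ ^ 2 with hJ₁
  set J₂ : ℝ := -(s₂ ^ 2) with hJ₂
  -- abbreviations
  set A := xyzLeftHamiltonian L j a hL n J₁ J₂ h with hA
  set B := xyzLeftHamiltonian L j a hL n J₁ J₂ (fun y => h (Torus.reflectBetweenSites j a y)) with hB
  set M := xyzCrossOp L j a hL n s₁ s₂ h with hM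
  set N := xyzCrossOp L j a hL n s₁ s₂ (fun y => h (Torus.reflectBetweenSites j a y)) with hN
  set e := torusSplit (q := n + 1) L j a hL with he
  -- the three Kronecker forms
  have hK : xyzRealFieldHamiltonian L n J₁ J₂ h = (A ⊗ₖ 1 + 1 ⊗ₖ B - ∑ i, M i ⊗ₖ N i).submatrix e e :=
    xyzRealFieldHamiltonian_eq_submatrix L j a hL n s₁ s₂ h
  have hKL : xyzRealFieldHamiltonian L n J₁ J₂ (reflectFieldLeft L j a h) =
      (A ⊗ₖ 1 + 1 ⊗ₖ A - ∑ i, M i ⊗ₖ M i).submatrix e e := by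
    rw [hJ₁, hJ₂, xyzRealFieldHamiltonian_eq_submatrix L j a hL n, ← hJ₁, ← hJ₂,
      xyzLeftHamiltonian_congr L j a n J₁ J₂ hL (fun x hx => reflectFieldLeft_of_mem L j a h hx),
      xyzLeftHamiltonian_congr L j a n J₁ J₂ hL
        (fun x hx => reflectFieldLeft_reflectBetweenSites_of_mem L j a hL h hx),
      xyzCrossOp_congr L j a n hL s₁ s₂ (fun x hx => reflectFieldLeft_of_mem L j a h hx),
      xyzCrossOp_congr L j a n hL s₁ s₂
        (fun x hx => reflectFieldLeft_reflectBetweenSites_of_mem L j a hL h hx)]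
  have hKR : xyzRealFieldHamiltonian L n J₁ J₂ (reflectFieldRight L j a h) =
      (B ⊗ₖ 1 + 1 ⊗ₖ B - ∑ i, N i ⊗ₖ N i).submatrix e e := by
    rw [hJ₁, hJ₂, xyzRealFieldHamiltonian_eq_submatrix L j a hL n, ← hJ₁, ← hJ₂,
      xyzLeftHamiltonian_congr L j a n J₁ J₂ hL (fun x hx => reflectFieldRight_of_mem L j a h hx),
      xyzLeftHamiltonian_congr L j a n J₁ J₂ hL
        (h₁ := fun y => reflectFieldRight L j a h (Torus.reflectBetweenSites j a y))
        (fun x hx => reflectFieldRight_reflectBetweenSites_of_mem L j a hL h hx),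
      xyzCrossOp_congr L j a n hL s₁ s₂ (fun x hx => reflectFieldRight_of_mem L j a h hx),
      xyzCrossOp_congr L j a n hL s₁ s₂
        (h₁ := fun y => reflectFieldRight L j a h (Torus.reflectBetweenSites j a y))
        (fun x hx => reflectFieldRight_reflectBetweenSites_of_mem L j a hL h hx)]
  -- Hermiticity of the three forms
  have herm : ∀ (f : TorusSite d L → ℝ) (K : Matrix _ _ ℂ),
      xyzRealFieldHamiltonian L n J₁ J₂ f = K.submatrix e e → K.IsHermitian := by
    intro f K hf
    have : K = (xyzRealFieldHamiltonian L n J₁ J₂ f).submatrix e.symm e.symm := by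
      rw [hf, submatrix_submatrix, Equiv.self_comp_symm, submatrix_id_id]
    rw [this]
    exact (xyzRealFieldHamiltonian_isHermitian L n J₁ J₂ f).submatrix _
  haveI : Nonempty ((torusLeftHalf L j a → Fin (n + 1)) × (torusLeftHalf L j a → Fin (n + 1))) :=
    ⟨(fun _ => 0, fun _ => 0)⟩
  have hRP := Matrix.kls_groundEnergy_reflection A B M N (xyzLeftHamiltonian_transpose L j a n J₁ J₂ hL h)
    (xyzLeftHamiltonian_transpose L j a n J₁ J₂ hL _) (fun i => xyzCrossOp_transpose_eq L j a n hL s₁ s₂ h i)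
    (fun i => xyzCrossOp_transpose_eq L j a n hL s₁ s₂ _ i) (herm _ _ hK) (herm _ _ hKL) (herm _ _ hKR)
  rw [hK, hKL, hKR, Matrix.groundEnergy_submatrix_equiv (herm _ _ hK),
    Matrix.groundEnergy_submatrix_equiv (herm _ _ hKL),
    Matrix.groundEnergy_submatrix_equiv (herm _ _ hKR)]
  exact hRP

end HalfSpace

/-! ### The descent: Gaussian domination -/

section Descent

variable (L : ℕ) [NeZero L] (n : ℕ)

/-- **No bad bonds ⇒ `H'(h) = H'(0)`**: if `h_x = h_y` on every bond then the field terms vanish.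
[cite: KLS1988JSP, p. 1027] -/
theorem xyzRealFieldHamiltonian_eq_of_badBondCount_eq_zero (J₁ J₂ : ℝ) {h : TorusSite d L → ℝ}
    (h0 : badBondCount L h = 0) :
    xyzRealFieldHamiltonian L n J₁ J₂ h = xyzRealFieldHamiltonian L n J₁ J₂ (fun _ => 0) := by
  classical
  rw [badBondCount, Finset.card_eq_zero, Finset.filter_eq_empty_iff] at h0
  unfold xyzRealFieldHamiltonian
  refine sum_congr rfl fun e he => ?_
  have h1 := h0 he
  rw [not_not] at h1
  induction e using Sym2.ind with
  | h x y =>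
    rw [Sym2.map_mk, Sym2.mk_isDiag_iff] at h1
    simp only [Sym2.lift_mk]
    exact xyzRealBond_eq_of_eq n J₁ J₂ h1

/-- **Ground-state Gaussian domination for the anisotropic model** (B–U Corollary 5.3 at
`β = ∞`; KLS eq. (18)): on the even torus of side `L ≥ 4`, for couplings `J₁ = s₁² ≥ 0`,
`J₂ = -s₂² ≤ 0` (third coupling `1`), all spins and all real fields `h`,
`E₀(H'(0)) ≤ E₀(H'(h))`. Proof: minimise `E(f) = E₀(H'(f))` over the finitely many fields with
values in the range of `h`; among the minimisers take one with the fewest bonds with `f_x ≠ f_y`; a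
bad bond and the planes through it would give, by `xyz_groundEnergy_reflect_le`, two more
minimisers one of which has fewer bad bonds (`badBondCount_reflect`); so the minimiser is constant
on bonds and `H'(f) = H'(0)`. [cite: BjornbergUeltschi2022, Corollary 5.3] -/
theorem xyz_gaussianDomination_real (hL : Even L) (h4 : 4 ≤ L) (s₁ s₂ : ℝ)
    (g : TorusSite d L → ℝ) :
    (xyzRealFieldHamiltonian (d := d) L n (s₁ ^ 2) (-(s₂ ^ 2)) (fun _ => 0)).groundEnergy ≤
      (xyzRealFieldHamiltonian L n (s₁ ^ 2) (-(s₂ ^ 2)) g).groundEnergy := by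
  classical
  have hL2 : 2 ≤ L := by omega
  set J₁ : ℝ := s₁ ^ 2 with hJ₁
  set J₂ : ℝ := -(s₂ ^ 2) with hJ₂
  -- the finite search space
  set V : Finset ℝ := (univ : Finset (TorusSite d L)).image g with hV
  set Ef : (TorusSite d L → V) → ℝ := fun f =>
    (xyzRealFieldHamiltonian L n J₁ J₂ (fun x => (f x : ℝ))).groundEnergy with hEf
  set Nf : (TorusSite d L → V) → ℕ := fun f => badBondCount L (fun x => (f x : ℝ)) with hNf
  set g' : TorusSite d L → V := fun x => ⟨g x, mem_image_of_mem g (mem_univ x)⟩ with hg'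
  haveI : Nonempty (TorusSite d L → V) := ⟨g'⟩
  obtain ⟨f₀, hf₀⟩ := Finite.exists_min Ef
  set S : Finset (TorusSite d L → V) := univ.filter fun f => Ef f = Ef f₀ with hS
  obtain ⟨f₁, hf₁S, hf₁min⟩ := S.exists_min_image Nf ⟨f₀, by simp [hS]⟩
  have hEf₁ : Ef f₁ = Ef f₀ := (mem_filter.1 hf₁S).2
  -- the minimiser has no bad bonds
  have hN0 : Nf f₁ = 0 := by
    by_contra hN
    -- a bad pair `(x₀, i)`
    obtain ⟨x₀, i, hbad⟩ : ∃ (x₀ : TorusSite d L) (i : Fin d),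
        (f₁ x₀ : ℝ) ≠ f₁ (x₀ + Pi.single i 1) := by
      obtain ⟨e, he⟩ := Finset.card_ne_zero.1 hN
      obtain ⟨heE, hbe⟩ := mem_filter.1 he
      revert heE hbe
      refine Sym2.ind (fun u v => ?_) e
      intro heE hbe
      rw [SimpleGraph.mem_edgeFinset, SimpleGraph.mem_edgeSet, torusGraph_adj_iff] at heE
      rw [Sym2.map_mk, Sym2.mk_isDiag_iff] at hbe
      obtain ⟨-, ⟨i, rfl⟩ | ⟨i, rfl⟩⟩ := heE
      · exact ⟨u, i, hbe⟩
      · exact ⟨v, i, fun h' => hbe h'.symm⟩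
    -- the planes through it
    set j := i
    obtain ⟨hxCS, hθx⟩ := add_single_mem_torusCrossSites L hL2 j x₀
    set a : ZMod L := x₀ j with ha
    -- the reflected fields, inside the search space
    set φ : TorusSite d L → ℝ := fun x => (f₁ x : ℝ) with hφ
    set fL : TorusSite d L → V := fun y =>
      if y ∈ torusLeftHalf L j a then f₁ y else f₁ (Torus.reflectBetweenSites j a y) with hfL
    set fR : TorusSite d L → V := fun y =>
      if y ∈ torusLeftHalf L j a then f₁ (Torus.reflectBetweenSites j a y) else f₁ y with hfR
    have hfLφ : (fun x => (fL x : ℝ)) = reflectFieldLeft L j a φ := by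
      funext y
      simp only [hfL, reflectFieldLeft, hφ]
      split_ifs <;> rfl
    have hfRφ : (fun x => (fR x : ℝ)) = reflectFieldRight L j a φ := by
      funext y
      simp only [hfR, reflectFieldRight, hφ]
      split_ifs <;> rfl
    -- energies: both reflected fields are minimisers
    have hRP := xyz_groundEnergy_reflect_le L j a n hL s₁ s₂ φ
    rw [← hJ₁, ← hJ₂] at hRP
    have hEL : Ef fL = (xyzRealFieldHamiltonian L n J₁ J₂ (reflectFieldLeft L j a φ)).groundEnergy := by
      simp only [hEf, hfLφ]
    have hER : Ef fR = (xyzRealFieldHamiltonian L n J₁ J₂ (reflectFieldRight L j a φ)).groundEnergy := by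
      simp only [hEf, hfRφ]
    have hE1 : Ef f₁ = (xyzRealFieldHamiltonian L n J₁ J₂ φ).groundEnergy := by simp only [hEf, hφ]
    have h1 := hf₀ fL
    have h2 := hf₀ fR
    rw [← hEL, ← hER, ← hE1, hEf₁] at hRP
    have hELm : Ef fL = Ef f₀ := by linarith
    have hERm : Ef fR = Ef f₀ := by linarith
    have hNL : Nf f₁ ≤ Nf fL := hf₁min fL (by simp [hS, hELm])
    have hNR : Nf f₁ ≤ Nf fR := hf₁min fR (by simp [hS, hERm])
    -- counting: `N(f^L) + N(f^R) + 2N_C = 2N(f)` with `N_C ≥ 1`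
    have hcount := badBondCount_reflect L j a hL φ
    have hNLφ : Nf fL = badBondCount L (reflectFieldLeft L j a φ) := by simp only [hNf, hfLφ]
    have hNRφ : Nf fR = badBondCount L (reflectFieldRight L j a φ) := by simp only [hNf, hfRφ]
    have hN1φ : Nf f₁ = badBondCount L φ := by simp only [hNf, hφ]
    have hC : 1 ≤ ∑ x ∈ torusCrossSites L j a,
        (if (Sym2.map φ s(x, Torus.reflectBetweenSites j a x)).IsDiag then 0 else 1) := by
      have hone : (if (Sym2.map φ s(x₀ + Pi.single j 1,
          Torus.reflectBetweenSites j a (x₀ + Pi.single j 1))).IsDiag then 0 else 1) = 1 := by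
        simp only [hθx, Sym2.map_mk, Sym2.mk_isDiag_iff]
        rw [if_neg]
        exact fun h' => hbad h'.symm
      calc 1 = (if (Sym2.map φ s(x₀ + Pi.single j 1,
          Torus.reflectBetweenSites j a (x₀ + Pi.single j 1))).IsDiag then 0 else 1) := hone.symm
        _ ≤ _ := Finset.single_le_sum (f := fun x =>
          if (Sym2.map φ s(x, Torus.reflectBetweenSites j a x)).IsDiag then 0 else 1)
          (fun _ _ => Nat.zero_le _) hxCS
    rw [← hNLφ, ← hNRφ, ← hN1φ] at hcount
    omega
  -- hence `H'(f₁) = H'(0)` and `E₀(H'(0)) = E(f₁) ≤ E(g)`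
  have hH : xyzRealFieldHamiltonian L n J₁ J₂ (fun x => (f₁ x : ℝ)) =
      xyzRealFieldHamiltonian L n J₁ J₂ (fun _ => 0) :=
    xyzRealFieldHamiltonian_eq_of_badBondCount_eq_zero L n J₁ J₂ hN0
  have hEg : Ef g' = (xyzRealFieldHamiltonian L n J₁ J₂ g).groundEnergy := by simp only [hEf, hg']
  have h1 : Ef f₁ = (xyzRealFieldHamiltonian (d := d) L n J₁ J₂ (fun _ => 0)).groundEnergy := by
    simp only [hEf, hH]
  rw [← hEg, ← h1, hEf₁]
  exact hf₀ g'

/-- **Ground-state Gaussian domination**, stated with the couplings: for `0 ≤ J₁`, `J₂ ≤ 0`, even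
side `L ≥ 4`, all spins and all real fields, `E₀(H'(0)) ≤ E₀(H'(h))`.
[cite: BjornbergUeltschi2022, Corollary 5.3] -/
theorem xyz_gaussianDomination_real' (hL : Even L) (h4 : 4 ≤ L) {J₁ J₂ : ℝ} (hJ₁ : 0 ≤ J₁)
    (hJ₂ : J₂ ≤ 0) (g : TorusSite d L → ℝ) :
    (xyzRealFieldHamiltonian (d := d) L n J₁ J₂ (fun _ => 0)).groundEnergy ≤
      (xyzRealFieldHamiltonian L n J₁ J₂ g).groundEnergy := by
  have h1 : J₁ = Real.sqrt J₁ ^ 2 := (Real.sq_sqrt hJ₁).symm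
  have h2 : J₂ = -(Real.sqrt (-J₂) ^ 2) := by rw [Real.sq_sqrt (by linarith)]; ring
  rw [h1, h2]
  exact xyz_gaussianDomination_real L n hL h4 _ _ g

end Descent

end Literature.MathematicalPhysics.QuantumLattice
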